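import Mathlib
import Summits.QuantumFields.YangMills.Theses.TransportFieldFano
import Summits.QuantumFields.YangMills.Theorems.TransportFieldFanoAdjointLoopDirichletWeakStubKinematicChain
import Summits.QuantumFields.YangMills.Theorems.TransportFieldFanoAdjointLoopDirichletWeakStubDWeightedPlaquetteMean
import HarnessLib

/-!
# Crux `TransportFieldFano.AdjointLoopDirichletWeak` ⟨stmt-QuantumFields-23362⟩ — CLOSED (line `birth`, planner ym-idea-4 g17)

The ADJOINT-LOOP DIRICHLET CEILING WITH POLYNOMIAL VOLUME LOSS: there is `k` (`= 6`) such that for every `ε > 0` there are `C, β₀` with, for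
`β ≥ β₀`, every `L` and every `l2`-normalised physical eigenfunction `Ω` of the zero-flux transfer operator at `λ₀`, the one-step Dirichlet
deficit of the adjoint Polyakov deviation `F = flowLift 0 (4 − (Re tr P₀)²)` obeys
`λ₀‖FΩ‖² − ⟨FΩ, K_β(FΩ)⟩ ≤ C·β^(ε−1)·L^k·λ₀·E_{Ω²}[F]`.
Assembly = the birth skeleton's sorry-free composition `AdjointLoopDirichletWeak_of` applied to the two landed registered stubs:
✓`stub_kinematicChain` (p740151: deficit ≤ `(2L/|Λ|)·Σ_x Σ_{j<L}` weighted temporal plaquette means) and ✓`stub_dWeightedPlaquetteMean`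
(this seat: each weighted mean ≤ `C·β^(ε−1)·L^4·λ₀·E[FΩ²]`, from the weighted lemma of ✓`…WeightedPlaquette` and the torelon floor
`E[FΩ²] ≥ e^{−15}/β²` of ✓`…TorelonFloor`); `Σ_x Σ_{j<L} c = |Λ|·L·c` and `(2L/|Λ|)·|Λ|·L·c = 2L²c`.
HONEST FRAMING: a support crux (rank 5) of the DRAFT line `TransportFieldFano` (the K2a uncertainty door) on the fixed lattice; the line's
deciding cruxes `CoherentToronFloor` / `MeanLoopCeilingWeak` / `TransportKineticCeiling`, K2a, R2ξ″ and every rung remain OPEN; nothing about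
infinite volume or the continuum; **the Yang–Mills mass gap is NOT proved.**  No `sorry`, no new axiom, no new definition.
References: [cite: ReedSimonIV1978, Thm. XIII.43]; [cite: Luscher1983, §2].
-/

set_option autoImplicit false

noncomputable section

open MeasureTheory Filter Topology Real
open scoped BigOperators

namespace Summit.QuantumFields.YangMills.Theorems.TransportFieldFano

open Summit.QuantumFields.YangMills.Theorems.FemtoTransferGap

/-- ★★★★ **Crux ⟨stmt-QuantumFields-23362⟩ `AdjointLoopDirichletWeak` BY NAME** — the route decl
`Summit.QuantumFields.YangMills.Theses.TransportFieldFano.AdjointLoopDirichletWeak`, from the two registered stubs of the birth skeleton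
(termwise bound of the double sum; `k = 4 + 2`, `C ↦ 2C`, `β₀ ↦ max β₀ 0`). [cite: ReedSimonIV1978, Thm. XIII.43] [cite: Luscher1983, §2] -/
theorem adjointLoopDirichletWeak_proof : _root_.Summit.QuantumFields.YangMills.Theses.TransportFieldFano.AdjointLoopDirichletWeak := by
  have h₁ : KinematicChainP := stub_kinematicChain
  have h₂ : DWeightedPlaquetteMeanP := stub_dWeightedPlaquetteMean
  obtain ⟨k, hk⟩ := h₂
  refine ⟨k + 2, fun ε hε => ?_⟩
  obtain ⟨C, β₀, hC⟩ := hk ε hε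
  refine ⟨2 * C, max β₀ 0, fun β hβ L _ Ω hΩ hn heig => ?_⟩
  have hβ₀ : β₀ ≤ β := le_trans (le_max_left _ _) hβ
  have hβ0 : 0 ≤ β := le_trans (le_max_right _ _) hβ
  have hch := h₁ β hβ0 L Ω hΩ hn heig
  have hpl := hC β hβ₀ L Ω hΩ hn heig
  simp only at hch hpl ⊢
  have hLpos : (0 : ℝ) < (L : ℝ) := by exact_mod_cast Nat.pos_of_ne_zero (NeZero.ne L)
  have hcard : (0 : ℝ) < (Fintype.card (Literature.MathematicalPhysics.QuantumFieldTheory.Site 3 L) : ℝ) := by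
    exact_mod_cast Fintype.card_pos
  refine hch.trans ?_
  -- bound each summand by the common constant
  have hsum : ∑ x : Literature.MathematicalPhysics.QuantumFieldTheory.Site 3 L, ∑ j ∈ Finset.range L, ∫ p, Ω p.1 * transferKernel su2Rep β p.1 p.2 * Ω p.2 * ((flowLiftAt x 0 (fun u : Literature.MathematicalPhysics.QuantumFieldTheory.GaugeConfig 3 1 SU2 => 4 - ((su2Rep (u ((0 : Literature.MathematicalPhysics.QuantumFieldTheory.Site 3 1), (0 : Fin 3)))).trace.re) ^ 2) p.1 + flowLiftAt x 0 (fun u : Literature.MathematicalPhysics.QuantumFieldTheory.GaugeConfig 3 1 SU2 => 4 - ((su2Rep (u ((0 : Literature.MathematicalPhysics.QuantumFieldTheory.Site 3 1), (0 : Fin 3)))).trace.re) ^ 2) p.2) * (4 - 2 * (((p.1 ((fun z : Literature.MathematicalPhysics.QuantumFieldTheory.Site 3 L => z.shift 0)^[j] x, 0) * (p.2 ((fun z : Literature.MathematicalPhysics.QuantumFieldTheory.Site 3 L => z.shift 0)^[j] x, 0))⁻¹ : SU2) : Matrix (Fin 2) (Fin 2) ℂ).trace.re))) ∂(configMeasure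 SU2 L).prod (configMeasure SU2 L) ≤
      ∑ x : Literature.MathematicalPhysics.QuantumFieldTheory.Site 3 L, ∑ j ∈ Finset.range L, C * β ^ (ε - 1) * (L : ℝ) ^ k * topValue su2Rep L β * l2 (fun U => flowLift 0 (fun u : Literature.MathematicalPhysics.QuantumFieldTheory.GaugeConfig 3 1 SU2 => 4 - ((su2Rep (u ((0 : Literature.MathematicalPhysics.QuantumFieldTheory.Site 3 1), (0 : Fin 3)))).trace.re) ^ 2) U * Ω U) Ω :=
    Finset.sum_le_sum fun x _ => Finset.sum_le_sum fun j hj => hpl x j (Finset.mem_range.mp hj)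
  refine (mul_le_mul_of_nonneg_left hsum (by positivity)).trans (le_of_eq ?_)
  rw [Finset.sum_const, Finset.sum_const, Finset.card_range, Finset.card_univ, nsmul_eq_mul, nsmul_eq_mul]
  have hL2 : (L : ℝ) ^ (k + 2) = (L : ℝ) ^ k * ((L : ℝ) * (L : ℝ)) := by
    rw [Real.rpow_add hLpos, Real.rpow_two, sq]
  rw [hL2]
  field_simp

end Summit.QuantumFields.YangMills.Theorems.TransportFieldFano

end
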